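import Literature.AlgebraicGeometry.Resolution.AffineBlowupAlgebra
import Mathlib.Algebra.Module.LocalizedModule.Basic
import Mathlib.LinearAlgebra.Isomorphisms
import Mathlib.RingTheory.Regular.IsSMulRegular
import HarnessLib

/-!
# The chart module `M_{(g)} = R[I/g] · M ⊆ M[1/g]` of the blow-up of a module

Topic: `Literature/AlgebraicGeometry/Resolution`. For a ring `R`, an ideal `I`, an element
`g ∈ I` and an `R`-module `M`, the quasi-coherent module `Bl_I(M) = (⊕ₙ Iⁿ M)~` on
`Bl_I(R) = Proj R[It]` (the strict transform of `M`, Raynaud–Gruson) has, on the chart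
`D₊(g t) = Spec R[I/g]`, the module of sections

`M_{(g)} =` the `R[I/g]`-submodule of `M[1/g]` generated by the image of `M`

(Česnavičius 2021, §3.12: "`Γ(R_{(i)}, Bl_I(M))` is the `R_{(i)}`-submodule `M_{(i)} ⊂ M[1/i]`
generated by the image of `M`. In particular, `i` is `M_{(i)}`-regular"). This file defines it
(`chartModule I g M`, over the tree's image model `blowupAlgebra I g ⊆ R[1/g]` of `R[I/g]`) and
proves the elementary facts used in the proof of Kawasaki's theorem on Cohen–Macaulay blow-ups
(loc. cit., proof of Thm. 3.13, (bam-1)–(bam-4); Kawasaki 2000, §4):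

* `mem_chartModule_iff` — `x ∈ M_{(g)}` iff `gⁿ x = m/1` for some `n` and `m ∈ IⁿM`
  (`M_{(g)} = ⋃ₙ g⁻ⁿ · IⁿM`);
* `chartModule.isSMulRegular_of_dvd` — divisors of powers of `g` are `M_{(g)}`-regular;
* `chartModuleMap` — functoriality in `M` (`R[I/g]`-linear), onto for onto maps
  (`chartModuleMap_surjective`), and its kernel (`mem_ker_chartModuleMap_iff`: `x ↦ 0` iff
  `gᴺ x ∈ (ker)/1`);
* `chartModule.smul_mem_of_mem_ker` — **the key to (bam-1)/(bam-4)**: if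
  `(IⁿM :_M bᵐ) ⊆ (IⁿM :_M r)` for all `n > 0` (Kawasaki's (KI-c)), then `r` multiplies the
  kernel of `M_{(g)} → (M/bᵐM)_{(g)}` into `bᵐ M_{(g)}`;
* `chartModule.isSMulRegular_of_forall_pow` — if `b` is injective on `IⁿM` for `n ≥ 1` then `b`
  is `M_{(g)}`-regular (used with (KI-b) and the Goto–Yamagishi lemma);
* `chartModule.ker_chartModuleMap_mkQ_eq_smul` — if `y` is `M/IⁿM`-regular for all `n ≥ 1`
  (Kawasaki's (KI-a)) then the kernel of `M_{(g)} → (M/yM)_{(g)}` is `y M_{(g)}`, so that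
  `M_{(g)}/y M_{(g)} ≅ (M/yM)_{(g)}` (loc. cit., "the snake lemma applied to
  `0 → ⊕ IⁿM → ⊕ M → ⊕ M/IⁿM → 0`");
* `chartModule.fg` — `M_{(g)}` is finitely generated if `M` is.

Everything is proved; no named facts.

## References

* [Cesnavicius2021] K. Česnavičius, *Macaulayfication of Noetherian schemes*, Duke Math. J. 170
  (2021), §3.12 (Blowing up modules) and proof of Thm. 3.13.
* [Kawasaki2000] T. Kawasaki, *On Macaulayfication of Noetherian schemes*, Trans. AMS 352 (2000),
  §4 (the sheaves `[R_M(b)]~`).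
* [RaynaudGruson1971] M. Raynaud, L. Gruson, *Critères de platitude et de projectivité*,
  Invent. Math. 13 (1971), I.5.1.1 (ii).
-/

noncomputable section

open IsLocalization Pointwise

namespace Literature.AlgebraicGeometry.Resolution

universe u

variable {R : Type u} [CommRing R] (I : Ideal R) (g : R)
variable (E : Type u) [AddCommGroup E] [Module R E]

/-! ## Elements of `R[I/g]` as fractions `y/gⁿ`, `y ∈ Iⁿ` -/

/-- `(g/1) · (1/g) = 1` in `R[1/g]`, powers. [folklore] -/
theorem algebraMap_pow_mul_invSelf_pow (n : ℕ) :
    algebraMap R (Localization.Away g) (g ^ n) * Away.invSelf g ^ n = 1 := by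
  rw [map_pow, ← mul_pow, Away.mul_invSelf, one_pow]

/-- **Every element of `R[I/g]` (`g ∈ I`) is `y/gⁿ` with `y ∈ Iⁿ`** (Stacks 052Q).
[cite: StacksProject, Tag 052Q] -/
theorem blowupAlgebra.exists_eq_mul_invSelf_pow (hg : g ∈ I) {z : Localization.Away g}
    (hz : z ∈ blowupAlgebra I g) :
    ∃ (n : ℕ) (y : R), y ∈ I ^ n ∧ z = algebraMap R (Localization.Away g) y * Away.invSelf g ^ n := by
  induction hz using Algebra.adjoin_induction with
  | mem z hz =>
    obtain ⟨x, hx, rfl⟩ := hz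
    exact ⟨1, x, by rwa [pow_one], by rw [pow_one]⟩
  | algebraMap r => exact ⟨0, r, by rw [pow_zero, Ideal.one_eq_top]; trivial, by rw [pow_zero, mul_one]⟩
  | add z z' _ _ ih ih' =>
    obtain ⟨n, y, hy, rfl⟩ := ih
    obtain ⟨n', y', hy', rfl⟩ := ih'
    refine ⟨n + n', y * g ^ n' + y' * g ^ n, Ideal.add_mem _ ?_ ?_, ?_⟩
    · rw [pow_add]; exact Ideal.mul_mem_mul hy (Ideal.pow_mem_pow hg n')
    · rw [add_comm n, pow_add]; exact Ideal.mul_mem_mul hy' (Ideal.pow_mem_pow hg n)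
    · have h1 := algebraMap_pow_mul_invSelf_pow g n
      have h2 := algebraMap_pow_mul_invSelf_pow g n'
      rw [map_pow] at h1 h2
      rw [map_add, map_mul, map_mul, map_pow, map_pow, add_mul]
      congr 1
      · calc algebraMap R (Localization.Away g) y * Away.invSelf g ^ n
            = algebraMap R _ y * Away.invSelf g ^ n *
                (algebraMap R (Localization.Away g) g ^ n' * Away.invSelf g ^ n') := by
              rw [h2, mul_one]
          _ = _ := by rw [pow_add]; ring
      · calc algebraMap R (Localization.Away g) y' * Away.invSelf g ^ n'
            = algebraMap R _ y' * Away.invSelf g ^ n' *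
                (algebraMap R (Localization.Away g) g ^ n * Away.invSelf g ^ n) := by
              rw [h1, mul_one]
          _ = _ := by rw [pow_add]; ring
  | mul z z' _ _ ih ih' =>
    obtain ⟨n, y, hy, rfl⟩ := ih
    obtain ⟨n', y', hy', rfl⟩ := ih'
    refine ⟨n + n', y * y', by rw [pow_add]; exact Ideal.mul_mem_mul hy hy', ?_⟩
    rw [map_mul, pow_add]
    ring

/-- `y/gⁿ ∈ R[I/g]` for `y ∈ Iⁿ`, as a term of the subalgebra. [cite: StacksProject, Tag 052Q] -/
def blowupAlgebra.divPow {n : ℕ} {y : R} (hy : y ∈ I ^ n) : blowupAlgebra I g :=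
  ⟨algebraMap R (Localization.Away g) y * Away.invSelf g ^ n,
    algebraMap_mul_invSelf_pow_mem_blowupAlgebra (I := I) (a := g) n hy⟩

/-- `divPow` is `y/gⁿ`. [folklore] -/
@[simp]
theorem blowupAlgebra.coe_divPow {n : ℕ} {y : R} (hy : y ∈ I ^ n) :
    (blowupAlgebra.divPow I g hy : Localization.Away g) =
      algebraMap R (Localization.Away g) y * Away.invSelf g ^ n := rfl

/-! ## The chart module -/

/-- **The chart module `M_{(g)} = R[I/g] · M ⊆ M[1/g]`** of `Bl_I(M)` on `D₊(gt) = Spec R[I/g]`: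
the `R[I/g]`-submodule of `M[1/g]` generated by the image of `M`.
[cite: Cesnavicius2021, §3.12] -/
def chartModule : Submodule (blowupAlgebra I g) (LocalizedModule (Submonoid.powers g) E) :=
  Submodule.span (blowupAlgebra I g)
    (Set.range (LocalizedModule.mkLinearMap (Submonoid.powers g) E))

/-- (Instance shortcut: the additive group structure of `M_{(g)}`; needed for quotients.) [folklore] -/
instance chartModule.instAddCommGroup : AddCommGroup (chartModule I g E) :=
  Submodule.addCommGroup _

variable {E} in
/-- `m/1 ∈ M_{(g)}`. [cite: Cesnavicius2021, §3.12] -/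
theorem mkLinearMap_mem_chartModule (m : E) :
    LocalizedModule.mkLinearMap (Submonoid.powers g) E m ∈ chartModule I g E :=
  Submodule.subset_span ⟨m, rfl⟩

/-- The action of `R[I/g]` on `M[1/g]` is through `R[1/g]`. [folklore] -/
theorem blowupAlgebra.smul_def (z : blowupAlgebra I g) (x : LocalizedModule (Submonoid.powers g) E) :
    z • x = (z : Localization.Away g) • x := rfl

/-- `gⁿ • x = (g/1)ⁿ • x`. [folklore] -/
theorem pow_smul_eq_algebraMap_smul (n : ℕ) (x : LocalizedModule (Submonoid.powers g) E) :
    g ^ n • x = algebraMap R (Localization.Away g) (g ^ n) • x :=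
  (algebraMap_smul (Localization.Away g) (g ^ n) x).symm

/-- `(1/g)ⁿ (gⁿ x) = x`. [folklore] -/
theorem invSelf_pow_smul_pow_smul (n : ℕ) (x : LocalizedModule (Submonoid.powers g) E) :
    (Away.invSelf g ^ n : Localization.Away g) • (g ^ n • x) = x := by
  rw [pow_smul_eq_algebraMap_smul, smul_smul, mul_comm, algebraMap_pow_mul_invSelf_pow, one_smul]

/-- `gⁿ ((1/g)ⁿ x) = x`. [folklore] -/
theorem pow_smul_invSelf_pow_smul (n : ℕ) (x : LocalizedModule (Submonoid.powers g) E) :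
    g ^ n • ((Away.invSelf g ^ n : Localization.Away g) • x) = x := by
  rw [pow_smul_eq_algebraMap_smul, smul_smul, algebraMap_pow_mul_invSelf_pow, one_smul]

/-- `gⁿ` acts injectively on `M[1/g]`. [folklore] -/
theorem pow_smul_injective (n : ℕ) :
    Function.Injective fun x : LocalizedModule (Submonoid.powers g) E => g ^ n • x :=
  fun x x' h => by
    have := congrArg (fun w => (Away.invSelf g ^ n : Localization.Away g) • w) h
    simpa only [invSelf_pow_smul_pow_smul] using this

variable {E} in
/-- `(1/g)ⁿ · (m/1) ∈ M_{(g)}` for `m ∈ IⁿM`. [cite: Cesnavicius2021, §3.12] -/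
theorem invSelf_pow_smul_mem_chartModule {n : ℕ} {m : E} (hm : m ∈ I ^ n • (⊤ : Submodule R E)) :
    (Away.invSelf g ^ n : Localization.Away g) • LocalizedModule.mkLinearMap (Submonoid.powers g) E m ∈
      chartModule I g E := by
  refine Submodule.smul_induction_on hm (fun y hy m _ => ?_) (fun m m' hm hm' => ?_)
  · rw [LinearMap.map_smul, ← algebraMap_smul (Localization.Away g) y, smul_smul, mul_comm]
    exact Submodule.smul_mem (chartModule I g E) (blowupAlgebra.divPow I g hy)
      (mkLinearMap_mem_chartModule I g m)
  · rw [map_add, smul_add]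
    exact Submodule.add_mem _ hm hm'

/-- **`M_{(g)} = ⋃ₙ g⁻ⁿ · IⁿM`**: `x ∈ M_{(g)}` iff `gⁿ x = m/1` for some `n` and some `m ∈ IⁿM`
(`g ∈ I`). [cite: Cesnavicius2021, §3.12] -/
theorem mem_chartModule_iff (hg : g ∈ I) (x : LocalizedModule (Submonoid.powers g) E) :
    x ∈ chartModule I g E ↔ ∃ (n : ℕ) (m : E), m ∈ I ^ n • (⊤ : Submodule R E) ∧
      g ^ n • x = LocalizedModule.mkLinearMap (Submonoid.powers g) E m := by
  constructor
  · intro hx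
    induction hx using Submodule.span_induction with
    | mem x hx =>
      obtain ⟨m, rfl⟩ := hx
      exact ⟨0, m, by rw [pow_zero, Ideal.one_eq_top, Submodule.top_smul]; trivial,
        by rw [pow_zero, one_smul]⟩
    | zero => exact ⟨0, 0, Submodule.zero_mem _, by rw [smul_zero, map_zero]⟩
    | add x x' _ _ ih ih' =>
      obtain ⟨n, m, hm, hx⟩ := ih
      obtain ⟨n', m', hm', hx'⟩ := ih'
      refine ⟨n + n', g ^ n' • m + g ^ n • m', Submodule.add_mem _ ?_ ?_, ?_⟩
      · rw [add_comm n, pow_add, Submodule.mul_smul]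
        exact Submodule.smul_mem_smul (Ideal.pow_mem_pow hg n') hm
      · rw [pow_add, Submodule.mul_smul]
        exact Submodule.smul_mem_smul (Ideal.pow_mem_pow hg n) hm'
      · rw [smul_add, map_add, LinearMap.map_smul, LinearMap.map_smul, ← hx, ← hx', smul_smul,
          smul_smul, ← pow_add, ← pow_add, add_comm n']
    | smul z x _ ih =>
      obtain ⟨n, m, hm, hx⟩ := ih
      obtain ⟨k, y, hy, hz⟩ := blowupAlgebra.exists_eq_mul_invSelf_pow I g hg z.2
      refine ⟨n + k, y • m, ?_, ?_⟩
      · rw [add_comm, pow_add, Submodule.mul_smul]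
        exact Submodule.smul_mem_smul hy hm
      · rw [blowupAlgebra.smul_def, hz, pow_smul_eq_algebraMap_smul, smul_smul, LinearMap.map_smul,
          ← hx, pow_smul_eq_algebraMap_smul, ← algebraMap_smul (Localization.Away g) y,
          smul_smul]
        congr 1
        have h1 := algebraMap_pow_mul_invSelf_pow g k
        rw [map_pow] at h1
        calc algebraMap R (Localization.Away g) (g ^ (n + k)) *
              (algebraMap R (Localization.Away g) y * Away.invSelf g ^ k)
            = algebraMap R _ y * algebraMap R _ (g ^ n) *
                (algebraMap R (Localization.Away g) g ^ k * Away.invSelf g ^ k) := by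
              rw [map_pow, map_pow, pow_add]; ring
          _ = algebraMap R _ y * algebraMap R _ (g ^ n) := by rw [h1, mul_one]
  · rintro ⟨n, m, hm, hx⟩
    rw [← invSelf_pow_smul_pow_smul g E n x, hx]
    exact invSelf_pow_smul_mem_chartModule I g hm

variable {E} in
/-- The representation may be taken with exponent `≥ 1` (indeed with any larger exponent).
[folklore] -/
theorem exists_rep_succ_of_mem_chartModule (hg : g ∈ I) {x : LocalizedModule (Submonoid.powers g) E}
    (hx : x ∈ chartModule I g E) (k : ℕ) :
    ∃ (n : ℕ) (m : E), k ≤ n ∧ m ∈ I ^ n • (⊤ : Submodule R E) ∧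
      g ^ n • x = LocalizedModule.mkLinearMap (Submonoid.powers g) E m := by
  obtain ⟨n, m, hm, hx⟩ := (mem_chartModule_iff I g E hg x).mp hx
  refine ⟨n + k, g ^ k • m, by omega, ?_, ?_⟩
  · rw [add_comm, pow_add, Submodule.mul_smul]
    exact Submodule.smul_mem_smul (Ideal.pow_mem_pow hg k) hm
  · rw [add_comm, pow_add, mul_smul, hx, LinearMap.map_smul]

/-! ## Regular elements -/

/-- **Divisors of powers of `g` act injectively on `M[1/g]`.** [folklore] -/
theorem smul_injective_of_dvd_pow {r : R} {n : ℕ} (h : r ∣ g ^ n) :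
    Function.Injective fun x : LocalizedModule (Submonoid.powers g) E => r • x := by
  obtain ⟨r', hr'⟩ := h
  intro x x' hxx'
  apply pow_smul_injective g E n
  change g ^ n • x = g ^ n • x'
  have : r' • (r • x) = r' • (r • x') := congrArg (fun w => r' • w) hxx'
  rwa [smul_smul, smul_smul, mul_comm, ← hr'] at this

/-- **Divisors of powers of `g` (in particular `g`) are `M_{(g)}`-regular** ("in particular, `i` is
`M_{(i)}`-regular"). [cite: Cesnavicius2021, §3.12] -/
theorem chartModule.isSMulRegular_of_dvd {r : R} {n : ℕ} (h : r ∣ g ^ n) :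
    IsSMulRegular (chartModule I g E) r := fun _ _ hxx' =>
  Subtype.ext (smul_injective_of_dvd_pow g E h (congrArg Subtype.val hxx'))

variable {E} in
/-- **Regularity transfer**: if `b` is injective on `IⁿM` for all `n ≥ 1`, then `b` is
`M_{(g)}`-regular. [cite: Cesnavicius2021, proof of Thm. 3.13, proof of Claim 3.13.2] -/
theorem chartModule.isSMulRegular_of_forall_pow (hg : g ∈ I) {b : R}
    (hb : ∀ n, 1 ≤ n → ∀ m ∈ I ^ n • (⊤ : Submodule R E), b • m = 0 → m = 0) :
    IsSMulRegular (chartModule I g E) b := by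
  have key : ∀ x : chartModule I g E, b • x = 0 → x = 0 := by
    intro x hbx
    obtain ⟨n, m, hn, hm, hx⟩ := exists_rep_succ_of_mem_chartModule I g hg x.2 1
    have hbx' : b • (x : LocalizedModule (Submonoid.powers g) E) = 0 := by
      rw [← Submodule.coe_smul_of_tower, hbx, Submodule.coe_zero]
    have h0 : LocalizedModule.mkLinearMap (Submonoid.powers g) E (b • m) = 0 := by
      rw [LinearMap.map_smul, ← hx, smul_comm, hbx', smul_zero]
    obtain ⟨⟨_, k, rfl⟩, hk⟩ :=
      (IsLocalizedModule.eq_zero_iff (Submonoid.powers g)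
        (LocalizedModule.mkLinearMap (Submonoid.powers g) E)).mp h0
    change g ^ k • (b • m) = 0 at hk
    rw [smul_comm] at hk
    have hgm : g ^ k • m ∈ I ^ (k + n) • (⊤ : Submodule R E) := by
      rw [pow_add, Submodule.mul_smul]
      exact Submodule.smul_mem_smul (Ideal.pow_mem_pow hg k) hm
    have hm0 := hb (k + n) (by omega) _ hgm hk
    apply Subtype.ext
    apply pow_smul_injective g E (k + n)
    change g ^ (k + n) • (x : LocalizedModule (Submonoid.powers g) E) = g ^ (k + n) • 0
    rw [smul_zero, pow_add, mul_smul, hx, ← LinearMap.map_smul, hm0, map_zero]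
  intro x x' h
  rw [← sub_eq_zero]
  apply key
  rw [smul_sub, sub_eq_zero]
  exact h

/-! ## Functoriality -/

section Map

variable {E}
variable {E' : Type u} [AddCommGroup E'] [Module R E'] (f : E →ₗ[R] E')

/-- `f[1/g] : M[1/g] → M'[1/g]`, `R`-linearly (Mathlib's `IsLocalizedModule.map`). [folklore] -/
abbrev locMapAway : LocalizedModule (Submonoid.powers g) E →ₗ[R] LocalizedModule (Submonoid.powers g) E' :=
  IsLocalizedModule.map (Submonoid.powers g) (LocalizedModule.mkLinearMap (Submonoid.powers g) E)
    (LocalizedModule.mkLinearMap (Submonoid.powers g) E') f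

/-- `f[1/g] (m/s) = f(m)/s`. [folklore] -/
theorem locMapAway_mk (m : E) (s : Submonoid.powers g) :
    locMapAway g f (LocalizedModule.mk m s) = LocalizedModule.mk (f m) s :=
  IsLocalizedModule.map_LocalizedModules _ f m s

/-- `f[1/g]` is `R[1/g]`-linear. [folklore] -/
theorem locMapAway_smul (w : Localization.Away g) (x : LocalizedModule (Submonoid.powers g) E) :
    locMapAway g f (w • x) = w • locMapAway g f x := by
  induction x using LocalizedModule.induction_on with
  | h m s =>
    induction w using Localization.induction_on with
    | H p =>
      obtain ⟨r, t⟩ := p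
      rw [LocalizedModule.mk_smul_mk, locMapAway_mk, locMapAway_mk, LocalizedModule.mk_smul_mk,
        LinearMap.map_smul]

/-- `f[1/g]` as an `R[I/g]`-linear map. [folklore] -/
def locMapAwayₐ : LocalizedModule (Submonoid.powers g) E →ₗ[blowupAlgebra I g]
    LocalizedModule (Submonoid.powers g) E' where
  toFun := locMapAway g f
  map_add' := map_add _
  map_smul' z x := locMapAway_smul g f (z : Localization.Away g) x

/-- `locMapAwayₐ` is `f[1/g]`. [folklore] -/
@[simp]
theorem locMapAwayₐ_apply (x : LocalizedModule (Submonoid.powers g) E) :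
    locMapAwayₐ I g f x = locMapAway g f x := rfl

/-- `f[1/g]` maps `M_{(g)}` into `M'_{(g)}`. [cite: Cesnavicius2021, §3.12] -/
theorem map_chartModule_le : (chartModule I g E).map (locMapAwayₐ I g f) ≤ chartModule I g E' := by
  rw [chartModule, Submodule.map_span, Submodule.span_le]
  rintro _ ⟨_, ⟨m, rfl⟩, rfl⟩
  rw [locMapAwayₐ_apply, LocalizedModule.mkLinearMap_apply, locMapAway_mk]
  exact mkLinearMap_mem_chartModule I g (f m)

/-- `f[1/g]` maps `M_{(g)}` ONTO `M'_{(g)}` if `f` is onto. [cite: Cesnavicius2021, §3.12] -/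
theorem map_chartModule_eq (hf : Function.Surjective f) :
    (chartModule I g E).map (locMapAwayₐ I g f) = chartModule I g E' := by
  refine le_antisymm (map_chartModule_le I g f) ?_
  rw [chartModule, Submodule.span_le]
  rintro _ ⟨m', rfl⟩
  obtain ⟨m, rfl⟩ := hf m'
  exact ⟨_, mkLinearMap_mem_chartModule I g m, by
    rw [locMapAwayₐ_apply, LocalizedModule.mkLinearMap_apply, locMapAway_mk]; rfl⟩

/-- **Functoriality of the chart module**: `M_{(g)} → M'_{(g)}` induced by `f : M → M'`,
`R[I/g]`-linear. [cite: Cesnavicius2021, §3.12] -/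
def chartModuleMap : chartModule I g E →ₗ[blowupAlgebra I g] chartModule I g E' :=
  (locMapAwayₐ I g f).restrict fun x hx => map_chartModule_le I g f ⟨x, hx, rfl⟩

/-- `chartModuleMap` is `f[1/g]` on elements. [folklore] -/
@[simp]
theorem coe_chartModuleMap (x : chartModule I g E) :
    (chartModuleMap I g f x : LocalizedModule (Submonoid.powers g) E') = locMapAway g f x := rfl

/-- `M_{(g)} → M'_{(g)}` is onto for `f` onto. [cite: Cesnavicius2021, §3.12] -/
theorem chartModuleMap_surjective (hf : Function.Surjective f) :
    Function.Surjective (chartModuleMap I g f) := by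
  rintro ⟨x', hx'⟩
  rw [← map_chartModule_eq I g f hf] at hx'
  obtain ⟨x, hx, rfl⟩ := hx'
  exact ⟨⟨x, hx⟩, rfl⟩

/-- **The kernel of `M_{(g)} → M'_{(g)}`**: `x ↦ 0` iff `gᴺ x = m/1` for some `N` and some
`m ∈ Iᴺ M ∩ ker f` (and one may ask `N ≥ 1`). [cite: Cesnavicius2021, proof of Thm. 3.13, (bam-1)] -/
theorem mem_ker_chartModuleMap_iff (hg : g ∈ I) (x : chartModule I g E) :
    x ∈ LinearMap.ker (chartModuleMap I g f) ↔ ∃ (N : ℕ) (m : E), 1 ≤ N ∧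
      m ∈ I ^ N • (⊤ : Submodule R E) ∧ f m = 0 ∧
        g ^ N • (x : LocalizedModule (Submonoid.powers g) E) =
          LocalizedModule.mkLinearMap (Submonoid.powers g) E m := by
  constructor
  · intro hx
    rw [LinearMap.mem_ker] at hx
    have hx0 : locMapAway g f x = 0 := by
      rw [← coe_chartModuleMap, hx, Submodule.coe_zero]
    obtain ⟨n, m, hn, hm, hxm⟩ := exists_rep_succ_of_mem_chartModule I g hg x.2 1
    have h1 : LocalizedModule.mkLinearMap (Submonoid.powers g) E' (f m) = 0 := by
      have := congrArg (locMapAway g f) hxm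
      rw [LinearMap.map_smul, hx0, smul_zero, LocalizedModule.mkLinearMap_apply,
        locMapAway_mk] at this
      exact this.symm
    obtain ⟨⟨_, k, rfl⟩, hk⟩ :=
      (IsLocalizedModule.eq_zero_iff (Submonoid.powers g)
        (LocalizedModule.mkLinearMap (Submonoid.powers g) E')).mp h1
    change g ^ k • f m = 0 at hk
    refine ⟨k + n, g ^ k • m, by omega, ?_, by rw [LinearMap.map_smul, hk], ?_⟩
    · rw [pow_add, Submodule.mul_smul]
      exact Submodule.smul_mem_smul (Ideal.pow_mem_pow hg k) hm
    · rw [pow_add, mul_smul, hxm, LinearMap.map_smul]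
  · rintro ⟨N, m, -, -, hfm, hxm⟩
    rw [LinearMap.mem_ker]
    apply Subtype.ext
    apply pow_smul_injective g E' N
    change g ^ N • locMapAway g f x = g ^ N • (0 : LocalizedModule _ E')
    rw [smul_zero, ← LinearMap.map_smul, hxm, LocalizedModule.mkLinearMap_apply,
      locMapAway_mk, hfm, LocalizedModule.zero_mk]

/-- **`M_{(g)} / ker ≅ M'_{(g)}`** for `f` onto. [cite: Cesnavicius2021, proof of Thm. 3.13, (bam-1)] -/
def chartModuleQuotKerEquiv (hf : Function.Surjective f) :
    (chartModule I g E ⧸ LinearMap.ker (chartModuleMap I g f)) ≃ₗ[blowupAlgebra I g]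
      chartModule I g E' :=
  LinearMap.quotKerEquivOfSurjective _ (chartModuleMap_surjective I g f hf)

end Map

/-! ## The kernel of `M_{(g)} → (M/N)_{(g)}`: colon conditions -/

section Colon

variable {E}

/-- **(KI-c) ⇒ the kernel of `M_{(g)} → (M/bᵐM)_{(g)}` is multiplied by `r` into `bᵐ M_{(g)}`**:
if `bᵐ m' ∈ IⁿM` implies `r m' ∈ IⁿM` for all `n ≥ 1` (`(IⁿM : bᵐ) ⊆ (IⁿM : r)`), then for
`x` in the kernel, `r x ∈ bᵐ M_{(g)}`. [cite: Cesnavicius2021, proof of Thm. 3.13, proof of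
Claim 3.13.2 ((bam-1) and "this follows from the property (KI-c)")] -/
theorem chartModule.smul_mem_of_mem_ker (hg : g ∈ I) {b : R} {k : ℕ} {r : R}
    (hcolon : ∀ n, 1 ≤ n → ∀ m' : E, b ^ k • m' ∈ I ^ n • (⊤ : Submodule R E) →
      r • m' ∈ I ^ n • (⊤ : Submodule R E))
    {x : chartModule I g E}
    (hx : x ∈ LinearMap.ker (chartModuleMap I g ((b ^ k • (⊤ : Submodule R E)).mkQ))) :
    r • x ∈ b ^ k • (⊤ : Submodule (blowupAlgebra I g) (chartModule I g E)) := by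
  obtain ⟨N, m, hN, hm, hfm, hxm⟩ := (mem_ker_chartModuleMap_iff I g _ hg x).mp hx
  rw [Submodule.mkQ_apply, Submodule.Quotient.mk_eq_zero,
    Submodule.mem_smul_pointwise_iff_exists] at hfm
  obtain ⟨m', -, rfl⟩ := hfm
  -- `m' ∈ (Iᴺ M : bᵏ) ⊆ (Iᴺ M : r)`
  have hrm' : r • m' ∈ I ^ N • (⊤ : Submodule R E) := hcolon N hN m' hm
  -- `r x = bᵏ · (g⁻ᴺ (r m')/1)`
  rw [Submodule.mem_smul_pointwise_iff_exists]
  refine ⟨⟨_, invSelf_pow_smul_mem_chartModule I g hrm'⟩, Submodule.mem_top, Subtype.ext ?_⟩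
  rw [Submodule.coe_smul_of_tower, Submodule.coe_smul_of_tower]
  apply pow_smul_injective g E N
  dsimp only
  rw [smul_comm, pow_smul_invSelf_pow_smul, smul_comm (g ^ N) r, hxm, ← map_smul, ← map_smul,
    smul_smul, smul_smul, mul_comm]

/-- **(KI-a) ⇒ the kernel of `M_{(g)} → (M/yM)_{(g)}` is `y M_{(g)}`**: if `y` is
`M/IⁿM`-regular for all `n ≥ 1` (`(IⁿM : y) = IⁿM`), then `ker = y M_{(g)}`, whence
`M_{(g)}/yM_{(g)} ≅ (M/yM)_{(g)}`. [cite: Cesnavicius2021, proof of Thm. 3.13 ("(KI-a) and the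
snake lemma … show that `r'` is `(⊕ IⁿM)`-regular with `(⊕ IⁿM)/r'(⊕ IⁿM) ≅ ⊕ Iⁿ(M/r'M)`")] -/
theorem chartModule.ker_chartModuleMap_mkQ_eq_smul (hg : g ∈ I) {y : R}
    (hy : ∀ n, 1 ≤ n → ∀ m' : E, y • m' ∈ I ^ n • (⊤ : Submodule R E) →
      m' ∈ I ^ n • (⊤ : Submodule R E)) :
    LinearMap.ker (chartModuleMap I g ((y • (⊤ : Submodule R E)).mkQ)) =
      y • (⊤ : Submodule (blowupAlgebra I g) (chartModule I g E)) := by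
  apply le_antisymm
  · intro x hx
    have := chartModule.smul_mem_of_mem_ker I g hg (b := y) (k := 1) (r := 1)
      (fun n hn m' h => by rw [one_smul]; exact hy n hn m' (by rwa [pow_one] at h))
      (x := x) (by rwa [pow_one])
    rwa [one_smul, pow_one] at this
  · intro x hx
    rw [Submodule.mem_smul_pointwise_iff_exists] at hx
    obtain ⟨z, -, rfl⟩ := hx
    rw [LinearMap.mem_ker, LinearMap.map_smul_of_tower]
    apply Subtype.ext
    rw [Submodule.coe_smul_of_tower, coe_chartModuleMap, Submodule.coe_zero]
    obtain ⟨n, m, hm, hzm⟩ := (mem_chartModule_iff I g E hg _).mp z.2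
    apply pow_smul_injective g _ n
    change g ^ n • (y • locMapAway g _ (z : LocalizedModule _ E)) = g ^ n • (0 : LocalizedModule _ _)
    rw [smul_zero, smul_comm, ← LinearMap.map_smul, hzm, LocalizedModule.mkLinearMap_apply,
      locMapAway_mk, LocalizedModule.smul'_mk, ← LocalizedModule.zero_mk 1]
    congr 1
    rw [Submodule.mkQ_apply, ← Submodule.Quotient.mk_smul, Submodule.Quotient.mk_eq_zero]
    exact Submodule.smul_mem_pointwise_smul _ _ _ Submodule.mem_top

end Colon

/-! ## Finiteness -/

/-- `M_{(g)}` is finitely generated over `R[I/g]` if `M` is finitely generated over `R`.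
[cite: Cesnavicius2021, §3.12] -/
theorem chartModule.fg [Module.Finite R E] : (chartModule I g E).FG := by
  obtain ⟨S, hS⟩ := Module.Finite.fg_top (R := R) (M := E)
  classical
  refine ⟨S.image (LocalizedModule.mkLinearMap (Submonoid.powers g) E), le_antisymm ?_ ?_⟩
  · rw [Submodule.span_le]
    rintro _ hx
    rw [Finset.coe_image] at hx
    obtain ⟨m, -, rfl⟩ := hx
    exact mkLinearMap_mem_chartModule I g m
  · rw [chartModule, Submodule.span_le]
    rintro _ ⟨m, rfl⟩
    have hm : m ∈ Submodule.span R (S : Set E) := by rw [hS]; trivial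
    induction hm using Submodule.span_induction with
    | mem m hm => exact Submodule.subset_span (by rw [Finset.coe_image]; exact ⟨m, hm, rfl⟩)
    | zero => rw [map_zero]; exact Submodule.zero_mem _
    | add m m' _ _ ih ih' => rw [map_add]; exact Submodule.add_mem _ ih ih'
    | smul r m _ ih =>
      rw [LinearMap.map_smul, ← algebraMap_smul (blowupAlgebra I g) r]
      exact Submodule.smul_mem _ _ ih

/-- `M_{(g)}` is a finite `R[I/g]`-module for `M` finite. [cite: Cesnavicius2021, §3.12] -/
instance chartModule.finite [Module.Finite R E] :
    Module.Finite (blowupAlgebra I g) (chartModule I g E) :=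
  Module.Finite.iff_fg.mpr (chartModule.fg I g E)

end Literature.AlgebraicGeometry.Resolution

end
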